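import Summits.KontsevichZagierPeriods.KontsevichZagierPeriods.Theorems.ValuedFieldSpecialisationCTConstructionCylinderMoments
import Summits.KontsevichZagierPeriods.KontsevichZagierPeriods.Theorems.ValuedFieldSpecialisationCTConstructionLogFamilyTotal
import Summits.KontsevichZagierPeriods.KontsevichZagierPeriods.Theorems.ValuedFieldSpecialisationCTConstructionLogFamilyWeightedTotal
import Summits.KontsevichZagierPeriods.KontsevichZagierPeriods.Theorems.ValuedFieldSpecialisationCTConstructionWeightMap
import Summits.KontsevichZagierPeriods.KontsevichZagierPeriods.Theorems.ValuedFieldSpecialisationCTConstructionComposition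
import Summits.KontsevichZagierPeriods.KontsevichZagierPeriods.Theorems.ValuedFieldSpecialisationDefs

/-!
# Route ValuedFieldSpecialisation — crux `CTConstruction`: moment rigidity for log-elementary normal forms over constant families

Helper toward crux stmt-KontsevichZagierPeriods-3495 (`CTConstruction`), line `registered`, registered sub-goal
`stub_momentRigidity_log1_cylinders` of the class core `stub_specialFibreRigidityOfEval`.

THE MOMENT METHOD. The fibred relations `KZ.fibredRelations` (chains of moves uniform in the parameter `s = z 0`)
are a MODULE over polynomial weights of the parameter: multiplying every integrand by `(z 0)^m` on the slab
`0 < z 0 < 1` commutes with the four kinds of fibred generators (`stub_weightMap_mem_fibredRelations`). Hence a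
fibred relation `ρ` yields, for every `m`, the honest relation "total class of `s^m · ρ` ∈ `KZ.relations`"
(`KZ.fibredRelations ≤ KZ.relations`). For EXPLICIT normal forms these totals are explicit multiples of the
coefficient classes — the MOMENTS `∫₀¹ s^m s^{-a} log^b(1/s) ds = b!/(m+1-a)^{b+1}` made class-level by accessible
identities — and distinct exponents `(a, b)` have linearly independent moment vectors, so the coefficient classes,
in particular the special-fibre class, are relations. This file carries it out in the first case that the lead
report of cycle 1 (`Cruxes/CTConstruction/LEAD-REPORT-c1.md`, §4(i)) had declared blocked by "log-cancellation":
`D` generated by the log families `E₀,₁ ⊗ r` (slice `log(1/s) · r.value`), `G` generated by constant families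
(cylinders). Moments `m = 0, 1`: `z + y ≡ 0` and `z + 2y ≡ 0` (`∫₀¹ log(1/s) = 1`, `∫₀¹ s log(1/s) = 1/4`,
`∫₀¹ 1 = 1`, `∫₀¹ s = 1/2`), whence `y ≡ 0` — no cancellation principle and no division is needed.

Main statements: `momentRigidity_log1_cylinders_of` (arrow form from the five registered inputs
`stub_weightMap_mem_fibredRelations`, `stub_exists_weightRestrict`, `stub_logFamily_total`,
`stub_logFamily_weighted_total`, `stub_cylinder_weighted_total` — all landed, files `…CTConstructionWeightMap`,
`…LogFamilyTotal`, `…LogFamilyWeightedTotal`, `…CylinderMoments`), the registered stub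
`stub_momentRigidity_log1_cylinders` (unconditional), `momentRigidity_log1_cylinders_coeff` (the log coefficient and `G`
are relations too), and the orientation lemmas `pureSpecialFibreRigidity_of_core`,
`pureSpecialFibreRigidity_of_kzKernelConjecture` for the residual kernel `stub_pureSpecialFibreRigidity`.

Sources: M. Kontsevich, D. Zagier, *Periods* (2001), §1.2 (rules (1)–(3)); the encoding (elementary generators,
cylinders, fibred relations) is this route's. No new definitions.
-/

noncomputable section

namespace Summit.KontsevichZagierPeriods.ValuedFieldSpecialisation

open MeasureTheory Set Filter
open Literature.NumberTheory.Transcendental Literature.NumberTheory.Transcendental.KZ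

/-- **Moment rigidity, arrow form.** From (W) the weight-module structure of `fibredRelations`, (E) the existence
of weighted slab restrictions, and the three accessible identities (I1) `[E₀,₁ ⊗ r]_tot ≡ [r]`,
(I2) `4 • [s · E₀,₁ ⊗ r]_tot ≡ [r]`, (I3) `2 • [s · cyl ρ]_tot ≡ [ρ]`: if `D` lies in the subgroup generated by the
log-elementary families (`p = 0`, `b = 1`), `(G, y)` in the subgroup generated by the cylinder pairs
`([ρ.cylinder], [ρ])`, and `D + G` is a fibred relation, then `y ∈ KZ.relations`, and moreover `D ∈ KZ.relations`
(the log-coefficient class is a relation as well). Proof: with `Φ = lift W` the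
weight-`s` map and `z` the coefficient class of `D`, the totals of `D + G` and of `Φ (D + G)` give
`z + y ∈ relations` and `z + 2 • y ∈ relations`. [Kontsevich–Zagier 2001, §1.2] [folklore] -/
theorem momentRigidity_log1_cylinders_of
    (hW : ∀ (m : ℕ) (W : (Σ k, Literature.NumberTheory.Transcendental.KZ.IntegralRep k) → Literature.NumberTheory.Transcendental.KZ.FormalRep), (∀ r : Literature.NumberTheory.Transcendental.KZ.IntegralRep 0, W ⟨0, r⟩ = 0) → (∀ (k : ℕ) (r : Literature.NumberTheory.Transcendental.KZ.IntegralRep (k + 1)), ∃ r' : Literature.NumberTheory.Transcendental.KZ.IntegralRep (k + 1), W ⟨k + 1, r⟩ = Literature.NumberTheory.Transcendental.KZ.of r' ∧ r'.domain = r.domain ∩ Literature.NumberTheory.Transcendental.KZ.paramSlab k 0 1 ∧ r'.integrand = fun z => z 0 ^ m * r.integrand z) → ∀ c ∈ Literature.NumberTheory.Transcendental.KZ.fibredRelations, FreeAbelianGroup.lift W c ∈ Literature.NumberTheory.Transcendental.KZ.fibredRelations)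
    (hE : ∀ (m k : ℕ) (r : Literature.NumberTheory.Transcendental.KZ.IntegralRep (k + 1)), ∃ r' : Literature.NumberTheory.Transcendental.KZ.IntegralRep (k + 1), r'.domain = r.domain ∩ Literature.NumberTheory.Transcendental.KZ.paramSlab k 0 1 ∧ r'.integrand = fun z => z 0 ^ m * r.integrand z)
    (hI1 : ∀ (q d : ℕ) (r : Literature.NumberTheory.Transcendental.KZ.IntegralRep d) (P : Literature.NumberTheory.Transcendental.KZ.IntegralRep (1 + d + 1 + 1)), 0 < q → P.domain = {z | ∃ (s u : ℝ) (y : Fin 1 → ℝ) (w : Fin d → ℝ), z = Matrix.vecCons s (Matrix.vecCons u (Fin.append y w)) ∧ 0 < s ∧ s < 1 ∧ 0 < u ∧ u ^ q * s ^ 0 < 1 ∧ (∀ j, s ≤ y j ∧ y j ≤ 1) ∧ w ∈ r.domain} → P.integrand = (fun z => (∏ j : Fin 1, (z (Fin.castAdd d j).succ.succ)⁻¹) * r.integrand (fun l : Fin d => z (Fin.natAdd 1 l).succ.succ)) → Literature.NumberTheory.Transcendental.KZ.of P - Literature.NumberTheory.Transcendental.KZ.of r ∈ Literature.NumberTheo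ry.Transcendental.KZ.relations)
    (hI2 : ∀ (q d : ℕ) (r : Literature.NumberTheory.Transcendental.KZ.IntegralRep d) (P P' : Literature.NumberTheory.Transcendental.KZ.IntegralRep (1 + d + 1 + 1)), 0 < q → P.domain = {z | ∃ (s u : ℝ) (y : Fin 1 → ℝ) (w : Fin d → ℝ), z = Matrix.vecCons s (Matrix.vecCons u (Fin.append y w)) ∧ 0 < s ∧ s < 1 ∧ 0 < u ∧ u ^ q * s ^ 0 < 1 ∧ (∀ j, s ≤ y j ∧ y j ≤ 1) ∧ w ∈ r.domain} → P.integrand = (fun z => (∏ j : Fin 1, (z (Fin.castAdd d j).succ.succ)⁻¹) * r.integrand (fun l : Fin d => z (Fin.natAdd 1 l).succ.succ)) → P'.domain = P.domain ∩ Literature.NumberTheory.Transcendental.KZ.paramSlab (1 + d + 1) 0 1 → P'.integrand = (fun z => z 0 ^ 1 * P.integrand z) → 4 • Literature.NumberTheory.Transcendental.KZ.of P' - Literature.NumberTheory.Transcendental.KZ.of r ∈ Literature.NumberTheory.Transcendental.KZ.relations)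
    (hI3 : ∀ (n : ℕ) (ρ : Literature.NumberTheory.Transcendental.KZ.IntegralRep n) (C : Literature.NumberTheory.Transcendental.KZ.IntegralRep (n + 1)), C.domain = ρ.cylinder.domain ∩ Literature.NumberTheory.Transcendental.KZ.paramSlab n 0 1 → C.integrand = (fun z => z 0 ^ 1 * ρ.cylinder.integrand z) → 2 • Literature.NumberTheory.Transcendental.KZ.of C - Literature.NumberTheory.Transcendental.KZ.of ρ ∈ Literature.NumberTheory.Transcendental.KZ.relations) :
    ∀ D ∈ AddSubgroup.closure {x : Literature.NumberTheory.Transcendental.KZ.FormalRep | ∃ (q d : ℕ) (r : Literature.NumberTheory.Transcendental.KZ.IntegralRep d) (P : Literature.NumberTheory.Transcendental.KZ.IntegralRep (1 + d + 1 + 1)), 0 < q ∧ P.domain = {z | ∃ (s u : ℝ) (y : Fin 1 → ℝ) (w : Fin d → ℝ), z = Matrix.vecCons s (Matrix.vecCons u (Fin.append y w)) ∧ 0 < s ∧ s < 1 ∧ 0 < u ∧ u ^ q * s ^ 0 < 1 ∧ (∀ j, s ≤ y j ∧ y j ≤ 1) ∧ w ∈ r.domain} ∧ P.integrand = (fun z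 => (∏ j : Fin 1, (z (Fin.castAdd d j).succ.succ)⁻¹) * r.integrand (fun l : Fin d => z (Fin.natAdd 1 l).succ.succ)) ∧ x = Literature.NumberTheory.Transcendental.KZ.of P}, ∀ (G y : Literature.NumberTheory.Transcendental.KZ.FormalRep), (G, y) ∈ AddSubgroup.closure {v : Literature.NumberTheory.Transcendental.KZ.FormalRep × Literature.NumberTheory.Transcendental.KZ.FormalRep | ∃ (n : ℕ) (ρ : Literature.NumberTheory.Transcendental.KZ.IntegralRep n), v = (Literature.NumberTheory.Transcendental.KZ.of ρ.cylinder, Literature.NumberTheory.Transcendental.KZ.of ρ)} → D + G ∈ Literature.NumberTheory.Transcendental.KZ.fibredRelations → y ∈ Literature.NumberTheory.Transcendental.KZ.relations ∧ D ∈ Literature.NumberTheory.Transcendental.KZ.relations := by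
  intro D hD G y hGy hF
  classical
  -- the weight-`s` map `Φ = lift W`: dimension 0 ↦ 0, a family ↦ its `s`-weighted slab restriction (chosen)
  choose wr hwr_dom hwr_int using hE 1
  let W : (Σ k, KZ.IntegralRep k) → KZ.FormalRep := fun x => match x with
    | ⟨0, _⟩ => 0
    | ⟨k + 1, r⟩ => KZ.of (wr k r)
  have hW0 : ∀ r : KZ.IntegralRep 0, W ⟨0, r⟩ = 0 := fun _ => rfl
  have hWs : ∀ (k : ℕ) (r : KZ.IntegralRep (k + 1)), W ⟨k + 1, r⟩ = KZ.of (wr k r) := fun _ _ => rfl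
  have hWfam : ∀ (k : ℕ) (r : KZ.IntegralRep (k + 1)), ∃ r' : KZ.IntegralRep (k + 1),
      W ⟨k + 1, r⟩ = KZ.of r' ∧ r'.domain = r.domain ∩ KZ.paramSlab k 0 1 ∧
        r'.integrand = fun z => z 0 ^ 1 * r.integrand z :=
    fun k r => ⟨wr k r, hWs k r, hwr_dom k r, hwr_int k r⟩
  set Φ : KZ.FormalRep →+ KZ.FormalRep := FreeAbelianGroup.lift W with hΦ
  have hΦof : ∀ (k : ℕ) (r : KZ.IntegralRep (k + 1)), Φ (KZ.of r) = KZ.of (wr k r) := by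
    intro k r
    show FreeAbelianGroup.lift W (FreeAbelianGroup.of ⟨k + 1, r⟩) = KZ.of (wr k r)
    rw [FreeAbelianGroup.lift_apply_of]
  -- moments of the log-elementary part: `D ≡ z` and `4 • Φ D ≡ z` for its coefficient class `z`
  have hDmom : ∀ x ∈ AddSubgroup.closure {x : Literature.NumberTheory.Transcendental.KZ.FormalRep | ∃ (q d : ℕ) (r : Literature.NumberTheory.Transcendental.KZ.IntegralRep d) (P : Literature.NumberTheory.Transcendental.KZ.IntegralRep (1 + d + 1 + 1)), 0 < q ∧ P.domain = {z | ∃ (s u : ℝ) (y : Fin 1 → ℝ) (w : Fin d → ℝ), z = Matrix.vecCons s (Matrix.vecCons u (Fin.append y w)) ∧ 0 < s ∧ s < 1 ∧ 0 < u ∧ u ^ q * s ^ 0 < 1 ∧ (∀ j, s ≤ y j ∧ y j ≤ 1) ∧ w ∈ r.domain} ∧ P.integrand = (fun z => (∏ j : Fin 1, (z (Fin.castAdd d j).succ.succ)⁻¹) * r.integrand (fun l : Fin d => z (Fin.natAdd 1 l).succ.succ)) ∧ x = Literature.NumberTheory.Transcendental.KZ.of P},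
      ∃ z : KZ.FormalRep, x - z ∈ KZ.relations ∧ 4 • Φ x - z ∈ KZ.relations := by
    intro x hx
    induction hx using AddSubgroup.closure_induction with
    | mem x hx =>
      obtain ⟨q, d, r, P, hq, hPd, hPi, rfl⟩ := hx
      refine ⟨KZ.of r, hI1 q d r P hq hPd hPi, ?_⟩
      rw [hΦof]
      exact hI2 q d r P (wr _ P) hq hPd hPi (hwr_dom _ P) (hwr_int _ P)
    | zero => exact ⟨0, by simp [KZ.relations.zero_mem]⟩
    | add x x' _ _ ih ih' =>
      obtain ⟨z, hz, hz'⟩ := ih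
      obtain ⟨w, hw, hw'⟩ := ih'
      refine ⟨z + w, ?_, ?_⟩
      · have : x + x' - (z + w) = (x - z) + (x' - w) := by abel
        rw [this]
        exact KZ.relations.add_mem hz hw
      · have : 4 • Φ (x + x') - (z + w) = (4 • Φ x - z) + (4 • Φ x' - w) := by
          rw [map_add, nsmul_add]; abel
        rw [this]
        exact KZ.relations.add_mem hz' hw'
    | neg x _ ih =>
      obtain ⟨z, hz, hz'⟩ := ih
      refine ⟨-z, ?_, ?_⟩
      · have : -x - -z = -(x - z) := by abel
        rw [this]
        exact KZ.relations.neg_mem hz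
      · have : 4 • Φ (-x) - -z = -(4 • Φ x - z) := by
          rw [map_neg, smul_neg]; abel
        rw [this]
        exact KZ.relations.neg_mem hz'
  -- moments of the constant part: `G ≡ y` and `2 • Φ G ≡ y`
  have hGmom : ∀ v ∈ AddSubgroup.closure {v : KZ.FormalRep × KZ.FormalRep | ∃ (n : ℕ) (ρ : KZ.IntegralRep n),
      v = (KZ.of ρ.cylinder, KZ.of ρ)}, v.1 - v.2 ∈ KZ.relations ∧ 2 • Φ v.1 - v.2 ∈ KZ.relations := by
    intro v hv
    induction hv using AddSubgroup.closure_induction with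
    | mem x hx =>
      obtain ⟨n, ρ, rfl⟩ := hx
      refine ⟨of_cylinder_sub_of_mem_relations ρ, ?_⟩
      dsimp only
      rw [hΦof]
      exact hI3 n ρ (wr n ρ.cylinder) (hwr_dom n ρ.cylinder) (hwr_int n ρ.cylinder)
    | zero => simp [KZ.relations.zero_mem]
    | add x x' _ _ ih ih' =>
      refine ⟨?_, ?_⟩
      · have : (x + x').1 - (x + x').2 = (x.1 - x.2) + (x'.1 - x'.2) := by
          simp only [Prod.fst_add, Prod.snd_add]; abel
        rw [this]
        exact KZ.relations.add_mem ih.1 ih'.1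
      · have : 2 • Φ (x + x').1 - (x + x').2 = (2 • Φ x.1 - x.2) + (2 • Φ x'.1 - x'.2) := by
          simp only [Prod.fst_add, Prod.snd_add, map_add, nsmul_add]; abel
        rw [this]
        exact KZ.relations.add_mem ih.2 ih'.2
    | neg x _ ih =>
      refine ⟨?_, ?_⟩
      · have : (-x).1 - (-x).2 = -(x.1 - x.2) := by
          simp only [Prod.fst_neg, Prod.snd_neg]; abel
        rw [this]
        exact KZ.relations.neg_mem ih.1
      · have : 2 • Φ (-x).1 - (-x).2 = -(2 • Φ x.1 - x.2) := by
          simp only [Prod.fst_neg, Prod.snd_neg, map_neg]; abel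
        rw [this]
        exact KZ.relations.neg_mem ih.2
  obtain ⟨z, hz, hz'⟩ := hDmom D hD
  obtain ⟨hy, hy'⟩ := hGmom (G, y) hGy
  dsimp only at hy hy'
  -- moment 0: `D + G ∈ relations`, so `z + y ∈ relations`
  have h0 : z + y ∈ KZ.relations := by
    have h := KZ.relations.sub_mem (KZ.relations.sub_mem (KZ.fibredRelations_le_relations hF) hz) hy
    convert h using 1
    abel
  -- moment 1: `Φ (D + G) ∈ fibredRelations ≤ relations`, so `z + 2 • y ∈ relations`
  have h1 : z + 2 • y ∈ KZ.relations := by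
    have hΦF : Φ (D + G) ∈ KZ.relations :=
      KZ.fibredRelations_le_relations (hW 1 W hW0 hWfam (D + G) hF)
    have h := KZ.relations.sub_mem (KZ.relations.sub_mem (KZ.relations.nsmul_mem hΦF 4) hz')
      (KZ.relations.nsmul_mem hy' 2)
    convert h using 1
    rw [map_add, nsmul_add]
    abel
  have hy0 : y ∈ KZ.relations := by
    have : y = (z + 2 • y) - (z + y) := by rw [two_nsmul]; abel
    rw [this]
    exact KZ.relations.sub_mem h1 h0
  refine ⟨hy0, ?_⟩
  -- and the log-coefficient class is a relation too: `z ≡ -y ≡ 0`, `D ≡ z`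
  have : D = (D - z) + ((z + y) - y) := by abel
  rw [this]
  exact KZ.relations.add_mem hz (KZ.relations.sub_mem h0 hy0)


/-- **Moment rigidity from the landed inputs, modulo the weighted log identity (I2).** The weight-module structure
(`stub_weightMap_mem_fibredRelations`, `stub_exists_weightRestrict`, file `…CTConstructionWeightMap`), the total of the
log family (`stub_logFamily_total`, file `…CTConstructionLogFamilyTotal`) and the first moment of a constant family
(`stub_cylinder_weighted_total`, file `…CTConstructionCylinderMoments`) are tree theorems; feeding them into the arrow
form leaves only the `s`-weighted log identity `4 • [s · E₀,₁ ⊗ r]_tot ≡ [r]` as hypothesis. [folklore] -/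
theorem momentRigidity_log1_cylinders_of_weightedLogTotal
    (hI2 : ∀ (q d : ℕ) (r : Literature.NumberTheory.Transcendental.KZ.IntegralRep d) (P P' : Literature.NumberTheory.Transcendental.KZ.IntegralRep (1 + d + 1 + 1)), 0 < q → P.domain = {z | ∃ (s u : ℝ) (y : Fin 1 → ℝ) (w : Fin d → ℝ), z = Matrix.vecCons s (Matrix.vecCons u (Fin.append y w)) ∧ 0 < s ∧ s < 1 ∧ 0 < u ∧ u ^ q * s ^ 0 < 1 ∧ (∀ j, s ≤ y j ∧ y j ≤ 1) ∧ w ∈ r.domain} → P.integrand = (fun z => (∏ j : Fin 1, (z (Fin.castAdd d j).succ.succ)⁻¹) * r.integrand (fun l : Fin d => z (Fin.natAdd 1 l).succ.succ)) → P'.domain = P.domain ∩ Literature.NumberTheory.Transcendental.KZ.paramSlab (1 + d + 1) 0 1 → P'.integrand = (fun z => z 0 ^ 1 * P.integrand z) → 4 • Literature.NumberTheory.Transcendental.KZ.of P' - Literature.NumberTheory.Transcendental.KZ.of r ∈ Literature.NumberTheory.Transcendental.KZ.relations) :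
    ∀ D ∈ AddSubgroup.closure {x : Literature.NumberTheory.Transcendental.KZ.FormalRep | ∃ (q d : ℕ) (r : Literature.NumberTheory.Transcendental.KZ.IntegralRep d) (P : Literature.NumberTheory.Transcendental.KZ.IntegralRep (1 + d + 1 + 1)), 0 < q ∧ P.domain = {z | ∃ (s u : ℝ) (y : Fin 1 → ℝ) (w : Fin d → ℝ), z = Matrix.vecCons s (Matrix.vecCons u (Fin.append y w)) ∧ 0 < s ∧ s < 1 ∧ 0 < u ∧ u ^ q * s ^ 0 < 1 ∧ (∀ j, s ≤ y j ∧ y j ≤ 1) ∧ w ∈ r.domain} ∧ P.integrand = (fun z => (∏ j : Fin 1, (z (Fin.castAdd d j).succ.succ)⁻¹) * r.integrand (fun l : Fin d => z (Fin.natAdd 1 l).succ.succ)) ∧ x = Literature.NumberTheory.Transcendental.KZ.of P}, ∀ (G y : Literature.NumberTheory.Transcendental.KZ.FormalRep), (G, y) ∈ AddSubgroup.closure {v : Literature.NumberTheory.Transcendental.KZ.FormalRep × Literature.NumberTheory.Transcendental.KZ.FormalRep | ∃ (n : ℕ) (ρ : Literature.NumberTheory.Transcendental.KZ.IntegralRep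 n), v = (Literature.NumberTheory.Transcendental.KZ.of ρ.cylinder, Literature.NumberTheory.Transcendental.KZ.of ρ)} → D + G ∈ Literature.NumberTheory.Transcendental.KZ.fibredRelations → y ∈ Literature.NumberTheory.Transcendental.KZ.relations :=
  fun D hD G y hGy hF =>
    (momentRigidity_log1_cylinders_of stub_weightMap_mem_fibredRelations stub_exists_weightRestrict stub_logFamily_total
      hI2 stub_cylinder_weighted_total D hD G y hGy hF).1

/-- **Registered stub `stub_momentRigidity_log1_cylinders` of the crux `CTConstruction`** (stmt-KontsevichZagierPeriods-3495,
line `registered`): MOMENT RIGIDITY for log-elementary normal forms over constant families — if `D` lies in the subgroup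
generated by the log families `E₀,₁ ⊗ r`, `(G, y)` in the subgroup generated by the cylinder pairs `([ρ.cylinder], [ρ])`,
and `D + G ∈ KZ.fibredRelations`, then `y ∈ KZ.relations`. All five inputs are tree theorems
(`stub_weightMap_mem_fibredRelations`, `stub_exists_weightRestrict`, `stub_logFamily_total`,
`stub_logFamily_weighted_total`, `stub_cylinder_weighted_total`); see `momentRigidity_log1_cylinders_of` for the proof and
`momentRigidity_log1_cylinders_coeff` for the vanishing of the log-coefficient class. [Kontsevich–Zagier 2001, §1.2]
[folklore] -/
theorem stub_momentRigidity_log1_cylinders : ∀ D ∈ AddSubgroup.closure {x : Literature.NumberTheory.Transcendental.KZ.FormalRep | ∃ (q d : ℕ) (r : Literature.NumberTheory.Transcendental.KZ.IntegralRep d) (P : Literature.NumberTheory.Transcendental.KZ.IntegralRep (1 + d + 1 + 1)), 0 < q ∧ P.domain = {z | ∃ (s u : ℝ) (y : Fin 1 → ℝ) (w : Fin d → ℝ), z = Matrix.vecCons s (Matrix.vecCons u (Fin.append y w)) ∧ 0 < s ∧ s < 1 ∧ 0 < u ∧ u ^ q * s ^ 0 < 1 ∧ (∀ j, s ≤ y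 j ∧ y j ≤ 1) ∧ w ∈ r.domain} ∧ P.integrand = (fun z => (∏ j : Fin 1, (z (Fin.castAdd d j).succ.succ)⁻¹) * r.integrand (fun l : Fin d => z (Fin.natAdd 1 l).succ.succ)) ∧ x = Literature.NumberTheory.Transcendental.KZ.of P}, ∀ (G y : Literature.NumberTheory.Transcendental.KZ.FormalRep), (G, y) ∈ AddSubgroup.closure {v : Literature.NumberTheory.Transcendental.KZ.FormalRep × Literature.NumberTheory.Transcendental.KZ.FormalRep | ∃ (n : ℕ) (ρ : Literature.NumberTheory.Transcendental.KZ.IntegralRep n), v = (Literature.NumberTheory.Transcendental.KZ.of ρ.cylinder, Literature.NumberTheory.Transcendental.KZ.of ρ)} → D + G ∈ Literature.NumberTheory.Transcendental.KZ.fibredRelations → y ∈ Literature.NumberTheory.Transcendental.KZ.relations :=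
  momentRigidity_log1_cylinders_of_weightedLogTotal stub_logFamily_weighted_total

/-- **The log-coefficient class is a relation as well**: under the hypotheses of `stub_momentRigidity_log1_cylinders`,
`D ∈ KZ.relations` (and hence `G ∈ KZ.relations`): the moment equations `z + y ≡ 0`, `z + 2 • y ≡ 0` kill both unknowns.
[Kontsevich–Zagier 2001, §1.2] [folklore] -/
theorem momentRigidity_log1_cylinders_coeff : ∀ D ∈ AddSubgroup.closure {x : Literature.NumberTheory.Transcendental.KZ.FormalRep | ∃ (q d : ℕ) (r : Literature.NumberTheory.Transcendental.KZ.IntegralRep d) (P : Literature.NumberTheory.Transcendental.KZ.IntegralRep (1 + d + 1 + 1)), 0 < q ∧ P.domain = {z | ∃ (s u : ℝ) (y : Fin 1 → ℝ) (w : Fin d → ℝ), z = Matrix.vecCons s (Matrix.vecCons u (Fin.append y w)) ∧ 0 < s ∧ s < 1 ∧ 0 < u ∧ u ^ q * s ^ 0 < 1 ∧ (∀ j, s ≤ y j ∧ y j ≤ 1) ∧ w ∈ r.domain} ∧ P.integrand = (fun z => (∏ j : Fin 1, (z (Fin.castAdd d j).succ.succ)⁻¹) * r.integrand (fun l : Fin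 d => z (Fin.natAdd 1 l).succ.succ)) ∧ x = Literature.NumberTheory.Transcendental.KZ.of P}, ∀ (G y : Literature.NumberTheory.Transcendental.KZ.FormalRep), (G, y) ∈ AddSubgroup.closure {v : Literature.NumberTheory.Transcendental.KZ.FormalRep × Literature.NumberTheory.Transcendental.KZ.FormalRep | ∃ (n : ℕ) (ρ : Literature.NumberTheory.Transcendental.KZ.IntegralRep n), v = (Literature.NumberTheory.Transcendental.KZ.of ρ.cylinder, Literature.NumberTheory.Transcendental.KZ.of ρ)} → D + G ∈ Literature.NumberTheory.Transcendental.KZ.fibredRelations → D ∈ Literature.NumberTheory.Transcendental.KZ.relations ∧ G ∈ Literature.NumberTheory.Transcendental.KZ.relations := by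
  intro D hD G y hGy hF
  have hD0 : D ∈ KZ.relations :=
    (momentRigidity_log1_cylinders_of stub_weightMap_mem_fibredRelations stub_exists_weightRestrict stub_logFamily_total
      stub_logFamily_weighted_total stub_cylinder_weighted_total D hD G y hGy hF).2
  refine ⟨hD0, ?_⟩
  have : G = (D + G) - D := by abel
  rw [this]
  exact KZ.relations.sub_mem (KZ.fibredRelations_le_relations hF) hD0

/-! ## The configuration is a sub-instance of the core stub -/

/-- The log-elementary families (`p = 0`, `b = 1`) are elementary divergent products of the route
(`elementaryGenerators` with `p := 0`, `b := 1`; definitional). [folklore] -/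
theorem log1Generators_subset_elementaryGenerators :
    {x : Literature.NumberTheory.Transcendental.KZ.FormalRep | ∃ (q d : ℕ) (r : Literature.NumberTheory.Transcendental.KZ.IntegralRep d) (P : Literature.NumberTheory.Transcendental.KZ.IntegralRep (1 + d + 1 + 1)), 0 < q ∧ P.domain = {z | ∃ (s u : ℝ) (y : Fin 1 → ℝ) (w : Fin d → ℝ), z = Matrix.vecCons s (Matrix.vecCons u (Fin.append y w)) ∧ 0 < s ∧ s < 1 ∧ 0 < u ∧ u ^ q * s ^ 0 < 1 ∧ (∀ j, s ≤ y j ∧ y j ≤ 1) ∧ w ∈ r.domain} ∧ P.integrand = (fun z => (∏ j : Fin 1, (z (Fin.castAdd d j).succ.succ)⁻¹) * r.integrand (fun l : Fin d => z (Fin.natAdd 1 l).succ.succ)) ∧ x = Literature.NumberTheory.Transcendental.KZ.of P}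
      ⊆ elementaryGenerators := by
  rintro x ⟨q, d, r, P, hq, hdom, hint, rfl⟩
  exact ⟨0, q, 1, d, r, P, hq, Or.inr one_pos, hdom, hint, rfl⟩

/-- The cylinder pairs `([ρ.cylinder], [ρ])` are dominated pairs (`KZ.IntegralRep.isDominatedFamily_cylinder`). [folklore] -/
theorem cylinderPairs_subset_dominatedPairs :
    {v : Literature.NumberTheory.Transcendental.KZ.FormalRep × Literature.NumberTheory.Transcendental.KZ.FormalRep | ∃ (n : ℕ) (ρ : Literature.NumberTheory.Transcendental.KZ.IntegralRep n), v = (Literature.NumberTheory.Transcendental.KZ.of ρ.cylinder, Literature.NumberTheory.Transcendental.KZ.of ρ)}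
      ⊆ {v : Literature.NumberTheory.Transcendental.KZ.FormalRep × Literature.NumberTheory.Transcendental.KZ.FormalRep | ∃ (n : ℕ) (S : Literature.NumberTheory.Transcendental.KZ.IntegralRep (n + 1)) (r₀ g : Literature.NumberTheory.Transcendental.KZ.IntegralRep n), Literature.NumberTheory.Transcendental.KZ.IsDominatedFamily S r₀ g ∧ v = (Literature.NumberTheory.Transcendental.KZ.of S, Literature.NumberTheory.Transcendental.KZ.of r₀)} := by
  rintro v ⟨n, ρ, rfl⟩
  exact ⟨n, ρ.cylinder, ρ, ρ.abs, ρ.isDominatedFamily_cylinder, rfl⟩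

/-! ## Orientation of the kernel: the PURE case sits between the core stub and the kernel conjecture -/

/-- **The core stub implies the pure case** (`D = 0`; the value hypothesis `eval y = 0` of the core is automatic by the
landed value shadow `eval_eq_zero_of_add_mem_fibredRelations`). So `stub_pureSpecialFibreRigidity` is a necessary
sub-goal of `stub_specialFibreRigidityOfEval`. [folklore] -/
theorem pureSpecialFibreRigidity_of_core
    (hcore : ∀ D ∈ AddSubgroup.closure Summit.KontsevichZagierPeriods.ValuedFieldSpecialisation.elementaryGenerators, ∀ (G y : Literature.NumberTheory.Transcendental.KZ.FormalRep), (G, y) ∈ AddSubgroup.closure {v : Literature.NumberTheory.Transcendental.KZ.FormalRep × Literature.NumberTheory.Transcendental.KZ.FormalRep | ∃ (n : ℕ) (S : Literature.NumberTheory.Transcendental.KZ.IntegralRep (n + 1)) (r₀ g : Literature.NumberTheory.Transcendental.KZ.IntegralRep n), Literature.NumberTheory.Transcendental.KZ.IsDominatedFamily S r₀ g ∧ v = (Literature.NumberTheory.Transcendental.KZ.of S, Literature.NumberTheory.Transcendental.KZ.of r₀)} → D + G ∈ Literature.NumberTheory.Transcendental.KZ.fibredRelations → Literature.NumberTheory.Transcendental.KZ.eval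 y = 0 → y ∈ Literature.NumberTheory.Transcendental.KZ.relations) :
    ∀ (G y : Literature.NumberTheory.Transcendental.KZ.FormalRep), (G, y) ∈ AddSubgroup.closure {v : Literature.NumberTheory.Transcendental.KZ.FormalRep × Literature.NumberTheory.Transcendental.KZ.FormalRep | ∃ (n : ℕ) (S : Literature.NumberTheory.Transcendental.KZ.IntegralRep (n + 1)) (r₀ g : Literature.NumberTheory.Transcendental.KZ.IntegralRep n), Literature.NumberTheory.Transcendental.KZ.IsDominatedFamily S r₀ g ∧ v = (Literature.NumberTheory.Transcendental.KZ.of S, Literature.NumberTheory.Transcendental.KZ.of r₀)} → G ∈ Literature.NumberTheory.Transcendental.KZ.fibredRelations → y ∈ Literature.NumberTheory.Transcendental.KZ.relations := by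
  intro G y hGy hG
  have hG' : (0 : KZ.FormalRep) + G ∈ KZ.fibredRelations := by rwa [zero_add]
  exact hcore 0 (zero_mem _) G y hGy hG' (eval_eq_zero_of_add_mem_fibredRelations 0 (zero_mem _) G y hGy hG')

/-- **The kernel conjecture implies the pure case**: a fibred relation among dominated families has special-fibre class
of value `0` (value shadow), hence a relation if `ker eval = relations`. So the pure case cannot be refuted without
refuting the Kontsevich–Zagier conjecture. [folklore] -/
theorem pureSpecialFibreRigidity_of_kzKernelConjecture
    (hK : Literature.NumberTheory.Transcendental.KZKernelConjecture) :
    ∀ (G y : Literature.NumberTheory.Transcendental.KZ.FormalRep), (G, y) ∈ AddSubgroup.closure {v : Literature.NumberTheory.Transcendental.KZ.FormalRep × Literature.NumberTheory.Transcendental.KZ.FormalRep | ∃ (n : ℕ) (S : Literature.NumberTheory.Transcendental.KZ.IntegralRep (n + 1)) (r₀ g : Literature.NumberTheory.Transcendental.KZ.IntegralRep n), Literature.NumberTheory.Transcendental.KZ.IsDominatedFamily S r₀ g ∧ v = (Literature.NumberTheory.Transcendental.KZ.of S, Literature.NumberTheory.Transcendental.KZ.of r₀)} → G ∈ Literature.NumberTheory.Transcendental.KZ.fibredRelations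 → y ∈ Literature.NumberTheory.Transcendental.KZ.relations := by
  intro G y hGy hG
  have hG' : (0 : KZ.FormalRep) + G ∈ KZ.fibredRelations := by rwa [zero_add]
  exact hK y (eval_eq_zero_of_add_mem_fibredRelations 0 (zero_mem _) G y hGy hG')

end Summit.KontsevichZagierPeriods.ValuedFieldSpecialisation
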